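import Summits.BirchSwinnertonDyer.BirchSwinnertonDyer.Theorems.KolyvaginRoadThreeMethod2LocalFrobenius
import Summits.BirchSwinnertonDyer.BirchSwinnertonDyer.Theorems.KolyvaginRoadThreeMethod2RankLoweringGood
import Literature.NumberTheory.EllipticCurves.HeegnerPointsKolyvaginProp81FrobeniusProofs
import Literature.NumberTheory.EllipticCurves.HeegnerPointsKolyvaginGoodReductionProofs
import Literature.NumberTheory.GaloisRepresentations.FrobeniusPlaces
import HarnessLib

/-!
# Route `KolyvaginRoadThree`, deciding crux `ZhangSharpFrameAtThreeHL` (item stmt-BirchSwinnertonDyer-19574):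
# the local inputs (Line) and (Trans) of stub A `stub_levelRaisingAtThree` DISCHARGED IN THE KERNEL at every good
# unipotent-admissible prime of an imaginary quadratic (indeed any quadratic) field
# (cell `bsd-stepL`, seat `bsd-stepL-zhang3-p1` g7; `--supports stmt-BirchSwinnertonDyer-19574`, helper)

WHY THIS FILE. koly3a's `Method2.selQ_rankLowering_on_of_localGlobal` (p464695) takes five local–global inputs at the
GOOD unipotent-admissible primes `q` of the method skeleton (`IsUAdmissiblePrime`: `q ∤ 3 N d_K`, `(q)` prime in
`𝓞_K`, `q ≡ 1 (mod 3)`, `3 ∤ a_q`; good = `FrobSqNeOneAt W 3 q`: `Frob_q² ≠ 1` on `E[3]`). This file PROVES two of them,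
(Line) and (Trans), IN THE BINDER SHAPES OF THAT THEOREM VERBATIM, for every number field `K` with `[K : ℚ] = 2`
(the stub's frame has `IsImaginaryQuadratic K`), with NO named fact beyond the tree's discharged ones: §1 finite
checks over `M₂(𝔽₃)` (`decide`: a determinant-one matrix with non-trivial square has square `−1` or unipotent `≠ 1`;
`ker N = range N` and `𝔽₃²/range N` cyclic for `N ≠ 0`, `N² = 0`); §2 for `h ∈ Γ_ℚ` with `χ̄₃(h) = 1`, `h² ≠ 1` on
`E[3]`: `E[3]^{h²} ⊆ (h² − 1)E[3]` and `E[3]/(h² − 1)E[3]` cyclic (Weil pairing `det ρ̄ = χ̄₃`, tree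
`det_eq_modPCyclotomicCharacterZMod_of_exists_weilPairing`); §3 at `v ∣ q`: an arithmetic Frobenius `F ∈ Γ_K` at the
prime `𝔓_{ι₀,𝔐}` of the local picture (`KolyvaginRoadThreeMethod2LocalFrobenius`) acting on `E(K̄)[3]` as `h²`, `h` the
`FrobSqNeOneAt` Frobenius moved above `𝔓_{ι₀,𝔐}` (`res F = h²`; `f(v|q) = 2` by the fundamental identity at the inert
`q`; tree `isArithFrobAt_of_absGaloisRestrict_eq_pow`), and `χ̄₃(h) = 1` from `q ≡ 1 (mod 3)` (Mathlib
`AlgHom.IsArithFrobAt.apply_of_pow_eq_one`); §4 (Line) and (Trans) VERBATIM (`E/K` good at `v ∤ 3` as `q ∤ 3N`).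
HONEST FRAMING: theorems only; no definition, no named fact, no `sorry`; (Cheb), (Equiv), (Iso) and stub B untouched;
nothing is booked. PARTITION: O2@3 (B10) × A1 × crux 19574 × stub A — none (kernel discharge of two typed inputs of
a registered stub; closes nothing; T7).

References: [cite: BertoliniDarmon2005, §2.2 Lemma 2.6] [cite: WZhang2014, §4.1, Prop. 5.4, Notations (xii)]
[cite: GrossLMS1991, §9 Prop. 9.6] [cite: NeukirchANT1999, Ch. I §9 (9.2)–(9.5)] [cite: SilvermanCSS1997, Ch. II §7–§8].
-/

noncomputable section

open scoped Classical Pointwise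
open WeierstrassCurve NumberField IsDedekindDomain Field Rat.HeightOneSpectrum
open Literature.NumberTheory.EllipticCurves Literature.NumberTheory.GaloisRepresentations Module

namespace Summit.BirchSwinnertonDyer.Rank1Residual.X11b.Three.Koly.Method2.LocalFrob

/-! ## §1 Finite checks over `M₂(𝔽₃)` -/

/-- **Squares in `SL₂(𝔽₃)`**: a matrix of determinant `1` whose square is not the identity has square `−1` or a
non-trivial unipotent square (`(H² − 1)² = 0`, `H² ≠ 1`). Finite check over the 81 matrices. [folklore] -/
theorem sq_eq_neg_one_or_unipotent :
    ∀ H : Matrix (Fin 2) (Fin 2) (ZMod 3), H.det = 1 → H * H ≠ 1 →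
      (H * H = -1 ∨ (H * H - 1 ≠ 0 ∧ (H * H - 1) * (H * H - 1) = 0)) := by
  decide

set_option maxRecDepth 16384 in
/-- **`ker N ⊆ range N`** for a non-zero `N ∈ M₂(𝔽₃)` with `N² = 0` (both are the same line). Finite check. [folklore] -/
theorem exists_eq_mulVec_of_mulVec_eq_zero :
    ∀ N : Matrix (Fin 2) (Fin 2) (ZMod 3), N ≠ 0 → N * N = 0 →
      ∀ y, N.mulVec y = 0 → ∃ m, y = N.mulVec m := by
  decide

set_option maxRecDepth 16384 in
/-- **`𝔽₃² / range N` is a line** for a non-zero `N ∈ M₂(𝔽₃)` with `N² = 0`: every vector outside `range N`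
generates the quotient. Finite check. [folklore] -/
theorem mem_range_or_generates :
    ∀ N : Matrix (Fin 2) (Fin 2) (ZMod 3), N ≠ 0 → N * N = 0 →
      ∀ y, (∃ m, y = N.mulVec m) ∨ ∀ z, ∃ (a : ZMod 3) (m : Fin 2 → ZMod 3), z = a • y + N.mulVec m := by
  decide

/-- `−1 − 1 = 1` in `M₂(𝔽₃)`. [folklore] -/
theorem neg_one_sub_one_eq_one : (-1 - 1 : Matrix (Fin 2) (Fin 2) (ZMod 3)) = 1 := by decide

/-! ## §2 The square of an element of `Γ_ℚ` of cyclotomic character `1` acting non-trivially on `E[3]` -/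

section Rational

variable (W : WeierstrassCurve ℚ) [W.IsElliptic]

/-- **Structure of `h²` on `E(ℚ̄)[3]`.** For `h ∈ Γ_ℚ` with `χ̄₃(h) = 1` and `h² ≠ 1` on `E[3]`: (i) every
`h²`-fixed point of `E[3]` lies in `(h² − 1)E[3]`; (ii) every `y ∈ E[3]` is in `(h² − 1)E[3]` or generates `E[3]`
modulo `(h² − 1)E[3]`. In a frame `E[3] ≃ 𝔽₃²` the matrix `H` of `h` has `det H = χ̄₃(h) = 1` (Weil pairing,
`det ρ̄_{E,3} = χ̄₃`: tree `det_eq_modPCyclotomicCharacterZMod_of_exists_weilPairing`), so by §1 `H² = −1`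
(then `H² − 1 = 1`) or `H² − 1` is a non-zero square-zero matrix. [cite: SilvermanCSS1997, Ch. II §7–§8] -/
theorem structure_of_sq_of_cyclotomic_eq_one {h : absoluteGaloisGroup ℚ}
    (hχ : modPCyclotomicCharacterZMod ℚ 3 h = 1)
    (hne : ∃ P : geomTorsion W ((3 ^ 1 : ℕ) : ℤ), h • h • P ≠ P) :
    (∀ y : geomTorsion W ((3 ^ 1 : ℕ) : ℤ), h • h • y = y →
        ∃ m : geomTorsion W ((3 ^ 1 : ℕ) : ℤ), y = h • h • m - m) ∧
      ∀ y : geomTorsion W ((3 ^ 1 : ℕ) : ℤ), (∃ m : geomTorsion W ((3 ^ 1 : ℕ) : ℤ), y = h • h • m - m) ∨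
        ∀ z : geomTorsion W ((3 ^ 1 : ℕ) : ℤ), ∃ (a : ℤ) (m : geomTorsion W ((3 ^ 1 : ℕ) : ℤ)),
          z = a • y + (h • h • m - m) := by
  -- a frame `E[3] ≃ 𝔽₃²` and the matrix of `h`
  have hT : ∀ P : geomTorsion W ((3 ^ 1 : ℕ) : ℤ), 3 • P = 0 := fun P ↦ by
    have := (mem_geomTorsion_iff W _ _).mp P.2
    apply Subtype.ext
    rw [AddSubgroupClass.coe_nsmul, ← natCast_zsmul]
    exact this
  have hcard : Nat.card (geomTorsion W ((3 ^ 1 : ℕ) : ℤ)) = 3 ^ 2 :=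
    card_torsionPoints_eq_sq_holds W (AlgebraicClosure ℚ) (n := 3 ^ 1) (by norm_num)
  obtain ⟨eT⟩ := KolyvaginImage.nonempty_addEquiv_of_card_eq_sq (p := 3) hT hcard
  set f : (Fin 2 → ZMod 3) →+ (Fin 2 → ZMod 3) :=
    (eT.toAddMonoidHom.comp (DistribSMul.toAddMonoidHom (geomTorsion W ((3 ^ 1 : ℕ) : ℤ)) h)).comp
      eT.symm.toAddMonoidHom with hf
  set H : Matrix (Fin 2) (Fin 2) (ZMod 3) := LinearMap.toMatrix' (f.toZModLinearMap 3) with hH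
  have hHP : ∀ P : geomTorsion W ((3 ^ 1 : ℕ) : ℤ), eT (h • P) = H.mulVec (eT P) := fun P ↦ by
    rw [hH, LinearMap.toMatrix'_mulVec, AddMonoidHom.coe_toZModLinearMap, hf]; simp
  -- `det H = χ̄₃(h) = 1`
  have hdet : H.det = 1 := by
    have h1 := det_eq_modPCyclotomicCharacterZMod_of_exists_weilPairing W 3 (exists_weilPairing_holds W 3) eT h H hHP
    rw [h1, hχ, Units.val_one]
  -- `H² ≠ 1`
  have hH2 : ∀ P : geomTorsion W ((3 ^ 1 : ℕ) : ℤ), eT (h • h • P) = (H * H).mulVec (eT P) := fun P ↦ by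
    rw [hHP, hHP, Matrix.mulVec_mulVec]
  have hsq : H * H ≠ 1 := by
    obtain ⟨P, hP⟩ := hne
    exact fun h1 ↦ hP (eT.injective (by rw [hH2, h1, Matrix.one_mulVec]))
  -- `(h² − 1)m` in the frame
  have hsub : ∀ m : geomTorsion W ((3 ^ 1 : ℕ) : ℤ), eT (h • h • m - m) = (H * H - 1).mulVec (eT m) := fun m ↦ by
    rw [map_sub, hH2, Matrix.sub_mulVec, Matrix.one_mulVec]
  rcases sq_eq_neg_one_or_unipotent H hdet hsq with hneg | ⟨hN0, hN2⟩
  · -- `H² = −1`: `h² = −1` on `E[3]`, `(h² − 1) = −2 = 1`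
    have hm1 : (H * H - 1 : Matrix (Fin 2) (Fin 2) (ZMod 3)) = 1 := by rw [hneg]; exact neg_one_sub_one_eq_one
    have hall : ∀ y : geomTorsion W ((3 ^ 1 : ℕ) : ℤ), y = h • h • y - y := fun y ↦ by
      apply eT.injective
      rw [hsub, hm1, Matrix.one_mulVec]
    exact ⟨fun y _ ↦ ⟨y, hall y⟩, fun y ↦ Or.inl ⟨y, hall y⟩⟩
  · -- `N = H² − 1 ≠ 0`, `N² = 0`
    refine ⟨fun y hy ↦ ?_, fun y ↦ ?_⟩
    · have hNy : (H * H - 1).mulVec (eT y) = 0 := by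
        rw [Matrix.sub_mulVec, Matrix.one_mulVec, ← hH2, hy, sub_self]
      obtain ⟨m', hm'⟩ := exists_eq_mulVec_of_mulVec_eq_zero _ hN0 hN2 _ hNy
      refine ⟨eT.symm m', eT.injective ?_⟩
      rw [hsub, eT.apply_symm_apply]
      exact hm'
    · rcases mem_range_or_generates _ hN0 hN2 (eT y) with ⟨m', hm'⟩ | hgen
      · refine Or.inl ⟨eT.symm m', eT.injective ?_⟩
        rw [hsub, eT.apply_symm_apply]
        exact hm'
      · refine Or.inr fun z ↦ ?_
        obtain ⟨a, m', hz⟩ := hgen (eT z)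
        refine ⟨(a.val : ℤ), eT.symm m', eT.injective ?_⟩
        rw [map_add, hsub, eT.apply_symm_apply, map_zsmul, hz,
          ← Int.cast_smul_eq_zsmul (ZMod 3) ((a.val : ℕ) : ℤ) (eT y), Int.cast_natCast, ZMod.natCast_zmod_val]

end Rational

/-! ## §3 The Frobenius at a place above a good unipotent-admissible prime of a quadratic field -/

section Quadratic

variable (W : WeierstrassCurve ℚ) [W.IsElliptic] [W.IsGloballyMinimal] (K : Type) [Field K] [NumberField K]

omit [W.IsGloballyMinimal] in
/-- **`E/ℚ` has good reduction at the place of `ℚ` above a prime `q ∤ N_E`** (`f_q = 0`; Silverman ATAEC IV.10.2(a);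
tree `factorization_conductorNorm_holds`, `conductorExponent_eq_zero_iff_holds` and the comparison lemmas, as in
`hasGoodReductionAt_of_isNewformOf_of_not_dvd`). [cite: Silverman1994, IV.10.2(a)] -/
theorem hasGoodReductionAt_rat_of_not_dvd_conductorNorm {q : ℕ} (hq : q.Prime) (hqN : ¬ q ∣ W.conductorNorm ℤ)
    (w : HeightOneSpectrum (𝓞 ℚ)) (hqw : (q : 𝓞 ℚ) ∈ w.asIdeal) : W.HasGoodReductionAt w := by
  have hpw : (primesEquiv w : ℕ) = q := primesEquiv_eq_of_natCast_mem hq hqw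
  set r : Nat.Primes := primesEquiv w with hr
  haveI := Fact.mk r.2
  set wZ : HeightOneSpectrum ℤ := (primesEquiv (R := ℤ)).symm r with hwZ
  have hgen : natGenerator wZ = r :=
    congrArg (fun s : Nat.Primes ↦ (s : ℕ)) ((primesEquiv (R := ℤ)).apply_symm_apply r)
  have hfe : W.conductorExponent wZ = 0 := by
    rw [← factorization_conductorNorm_holds W wZ, hgen, hpw]
    exact Nat.factorization_eq_zero_of_not_dvd hqN
  have hgZ : W.HasGoodReductionAt wZ := (conductorExponent_eq_zero_iff_holds wZ W).mp hfe
  have hgP : W.HasGoodReductionAtPrime r := (W.hasGoodReductionAtPrime_iff_hasGoodReductionAt_holds r).mpr hgZ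
  exact (hasGoodReductionAtPrime_iff_hasGoodReductionAt_ringOfIntegers w W).mp hgP

/-- **The residue degree of an inert prime of a quadratic field is `2`** (fundamental identity `#{w ∣ q}·f = [K:ℚ]`
at the unramified `q`, with a single place above `q`). [cite: NeukirchANT1999, Ch. I §9 (9.2)] -/
theorem inertiaDeg_eq_two_of_isPrime_span (hK2 : Module.finrank ℚ K = 2) {q : ℕ} (hq : q.Prime)
    (hprime : (Ideal.span {(q : 𝓞 K)}).IsPrime) (v : HeightOneSpectrum (𝓞 K)) (hqv : (q : 𝓞 K) ∈ v.asIdeal) :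
    v.asIdeal.inertiaDeg (𝓞 ℚ) = 2 := by
  haveI : Algebra.IsQuadraticExtension ℚ K := ⟨hK2⟩
  set w : HeightOneSpectrum (𝓞 ℚ) := v.under (𝓞 ℚ) with hw
  have hqw : (q : 𝓞 ℚ) ∈ w.asIdeal := by
    change (q : 𝓞 ℚ) ∈ v.asIdeal.under (𝓞 ℚ)
    rw [Ideal.under_def, Ideal.mem_comap, map_natCast]; exact hqv
  have hunr : Algebra.IsUnramifiedIn (𝓞 K) w.asIdeal := isUnramifiedIn_of_span_natCast_isPrime hq hprime hqw
  have hcard1 : Nat.card {w' : HeightOneSpectrum (𝓞 K) // w'.under (𝓞 ℚ) = w} = 1 := by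
    rw [Nat.card_eq_one_iff_exists]
    refine ⟨⟨v, rfl⟩, fun w' ↦ Subtype.ext ?_⟩
    have hq' : (q : 𝓞 ℚ) ∈ (w'.1.under (𝓞 ℚ)).asIdeal := by rw [w'.2]; exact hqw
    change (q : 𝓞 ℚ) ∈ w'.1.asIdeal.under (𝓞 ℚ) at hq'
    rw [Ideal.under_def, Ideal.mem_comap, map_natCast] at hq'
    exact placesAbove_eq_of_isPrime_span K hprime hq.ne_zero hqv hq'
  have h := natCard_placesOver_mul_inertiaDeg (F := ℚ) (M := K) hunr (w₀ := v) rfl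
  rw [hcard1, one_mul, hK2] at h
  exact h

/-- **The square of a Frobenius of `ℚ` over a quadratic field is a restriction.** For `[K : ℚ] = 2` and any
`h ∈ Γ_ℚ`, `h²` lies in the image of `Γ_K → Γ_ℚ` (its transport restricts to `K` as the square of an element of the
group `Aut(K/ℚ)` of order `2`). [folklore] -/
theorem sq_mem_range_absGaloisRestrict (hK2 : Module.finrank ℚ K = 2) (h : absoluteGaloisGroup ℚ) :
    h ^ 2 ∈ Set.range (absGaloisRestrict ℚ K) := by
  haveI : Algebra.IsQuadraticExtension ℚ K := ⟨hK2⟩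
  rw [mem_range_absGaloisRestrict_iff]
  intro x
  set tA := absGaloisTransport (K := ℚ) (L := K) h with htA
  have hcard : Nat.card (K ≃ₐ[ℚ] K) = 2 := by rw [IsGalois.card_aut_eq_finrank, hK2]
  have hσ2 : AlgEquiv.restrictNormalHom K tA ^ 2 = 1 := by
    rw [← hcard]; exact pow_card_eq_one'
  have h2 : (tA ^ 2).restrictNormal K = 1 := by
    rw [← hσ2]
    change AlgEquiv.restrictNormalHom K (tA ^ 2) = _
    rw [map_pow]
  have hc := AlgEquiv.restrictNormal_commutes (tA ^ 2) K x
  rw [h2, AlgEquiv.one_apply] at hc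
  rw [map_pow, ← htA]
  exact hc.symm

/-- **An arithmetic Frobenius above `q ≡ 1 (mod 3)` has trivial mod-3 cyclotomic character**: it raises the cube
roots of unity of `ℚ̄` (which are integral, and pairwise distinct modulo a prime not above `3`) to the `q`-th power
(Mathlib `AlgHom.IsArithFrobAt.apply_of_pow_eq_one`), i.e. fixes them. [folklore] -/
theorem modPCyclotomicCharacterZMod_three_eq_one_of_isArithFrobAt {q : ℕ} (hq : q.Prime) (hq3 : q % 3 = 1)
    {w : HeightOneSpectrum (𝓞 ℚ)} (hqw : (q : 𝓞 ℚ) ∈ w.asIdeal)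
    {𝔓 : Ideal (absIntegers (𝓞 ℚ) ℚ)} (h𝔓 : 𝔓 ∈ w.primesAbove) {h : absoluteGaloisGroup ℚ}
    (hh : IsArithFrobAt (𝓞 ℚ) h 𝔓) :
    modPCyclotomicCharacterZMod ℚ 3 h = 1 := by
  haveI := h𝔓.1
  -- `h` fixes every cube root of unity
  have hfix : ∀ t : AlgebraicClosure ℚ, t ^ 3 = 1 → h • t = t := by
    intro t ht
    have hint : IsIntegral (𝓞 ℚ) t := IsIntegral.of_pow (by norm_num : 0 < 3) (by rw [ht]; exact isIntegral_one)
    set ζ : absIntegers (𝓞 ℚ) ℚ := ⟨t, hint⟩ with hζ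
    have hζ3 : ζ ^ 3 = 1 := Subtype.ext ht
    have h3 : ((3 : ℕ) : absIntegers (𝓞 ℚ) ℚ) ∉ 𝔓 := by
      intro h3
      have h3' : ((3 : ℕ) : 𝓞 ℚ) ∈ w.asIdeal := by
        rw [h𝔓.2.over, Ideal.under_def, Ideal.mem_comap, map_natCast]; exact h3
      exact Summit.BirchSwinnertonDyer.Rank1Residual.X11b.Three.Koly.Method2.not_mem_asIdeal_of_coprime ℚ
        ((Nat.coprime_primes hq Nat.prime_three).mpr (by rintro rfl; norm_num at hq3)) w hqw h3'
    have happ := hh.apply_of_pow_eq_one hζ3 h3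
    rw [MulSemiringAction.toAlgHom_apply, HeightOneSpectrum.card_quotient_under_eq_residueCard h𝔓] at happ
    have hres : w.residueCard = q := by
      rw [HeightOneSpectrum.residueCard, ← span_natCast_rat_eq hq hqw, Ideal.absNorm_span_singleton,
        show (q : 𝓞 ℚ) = algebraMap ℤ (𝓞 ℚ) (q : ℤ) by simp, Algebra.norm_algebraMap,
        NumberField.RingOfIntegers.rank, Module.finrank_self, pow_one, Int.natAbs_natCast]
    rw [hres, ← Nat.div_add_mod q 3, hq3, pow_add, pow_mul, hζ3, one_pow, one_mul, pow_one] at happ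
    have := congrArg Subtype.val happ
    rwa [integralClosure.coe_smul] at this
  ext
  refine (modularCyclotomicCharacter.unique (AlgebraicClosure ℚ)
    (HasEnoughRootsOfUnity.natCard_rootsOfUnity (AlgebraicClosure ℚ) 3) _ fun t ht => ?_).symm
  rw [Units.val_one, ZMod.val_one, pow_one]
  have ht' : ((t : (AlgebraicClosure ℚ)ˣ) : AlgebraicClosure ℚ) ^ 3 = 1 := by
    rw [← Units.val_pow_eq_pow_val, (mem_rootsOfUnity 3 t).mp ht, Units.val_one]
  exact hfix (t : AlgebraicClosure ℚ) ht'

/-- **The Frobenius of the local picture at a place above a good unipotent-admissible prime, and its structure on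
`E(K̄)[3]`.** Let `[K : ℚ] = 2`, `q` unipotent-admissible with `Frob_q² ≠ 1` on `E[3]` (`FrobSqNeOneAt`), `v ∣ q` the
(unique) place of `K`, `𝔐` a prime of `\bar 𝓞_v` above `𝓂_v` and `𝔓 = 𝔓_{ι₀,𝔐}`. Then there is an arithmetic
Frobenius `F ∈ Γ_K` at `𝔓` such that every `F`-fixed point of `E(K̄)[3]` lies in `(F − 1)E(K̄)[3]` and every element of
`E(K̄)[3]` is in `(F − 1)E(K̄)[3]` or generates the quotient. Construction: move the `FrobSqNeOneAt` Frobenius `h` to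
`𝔓 ∩ \bar ℤ` by conjugation; `h²` is a restriction `res F` (`[K:ℚ] = 2`) and `F` is a Frobenius at `𝔓` because
`f(v|q) = 2`; `F` acts on `E(K̄)[3] ≃ E(ℚ̄)[3]` as `h²`, and §2 applies since `χ̄₃(h) = 1` (`q ≡ 1 (mod 3)`).
[cite: NeukirchANT1999, Ch. I §9 (9.4)–(9.5)] [cite: WZhang2014, Notations (xii)] -/
theorem exists_frob_structure_of_uAdmissible (hK2 : Module.finrank ℚ K = 2) {q : ℕ} (hq : IsUAdmissiblePrime W K q)
    (hgoodq : FrobSqNeOneAt W 3 q) (v : HeightOneSpectrum (𝓞 K)) (hqv : (q : 𝓞 K) ∈ v.asIdeal)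
    {𝔐 : Ideal (HeightOneSpectrum.localAbsIntegers v)} (h𝔐 : 𝔐 ∈ v.localPrimesAbove) :
    ∃ F : absoluteGaloisGroup K,
      IsArithFrobAt (𝓞 K) F (v.primeBelow (closureEmb (K := K) (v.adicCompletion K)) 𝔐) ∧
      (∀ y : geomTorsion (W.baseChange K) ((3 ^ 1 : ℕ) : ℤ), F • y = y →
        ∃ m : geomTorsion (W.baseChange K) ((3 ^ 1 : ℕ) : ℤ), y = F • m - m) ∧
      ∀ y : geomTorsion (W.baseChange K) ((3 ^ 1 : ℕ) : ℤ),
        (∃ m : geomTorsion (W.baseChange K) ((3 ^ 1 : ℕ) : ℤ), y = F • m - m) ∨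
        ∀ z : geomTorsion (W.baseChange K) ((3 ^ 1 : ℕ) : ℤ),
          ∃ (a : ℤ) (m : geomTorsion (W.baseChange K) ((3 ^ 1 : ℕ) : ℤ)), z = a • y + (F • m - m) := by
  haveI : Algebra.IsQuadraticExtension ℚ K := ⟨hK2⟩
  obtain ⟨hqprime, -, -, -, hinert, hq3, -⟩ := hq
  set ι₀ := closureEmb (K := K) (v.adicCompletion K) with hι₀
  set 𝔓 := v.primeBelow ι₀ 𝔐 with h𝔓def
  have h𝔓 : 𝔓 ∈ v.primesAbove := HeightOneSpectrum.primeBelow_mem_primesAbove h𝔐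
  set w : HeightOneSpectrum (𝓞 ℚ) := v.under (𝓞 ℚ) with hw
  have hwv : v.asIdeal.under (𝓞 ℚ) = w.asIdeal := rfl
  have hqw : (q : 𝓞 ℚ) ∈ w.asIdeal := by
    rw [← hwv, Ideal.under_def, Ideal.mem_comap, map_natCast]; exact hqv
  set 𝔓' := 𝔓.comap (absIntegersMap ℚ K) with h𝔓'def
  have h𝔓' : 𝔓' ∈ w.primesAbove := comap_absIntegersMap_mem_primesAbove hwv h𝔓
  -- the `FrobSqNeOneAt` Frobenius, moved to `𝔓'`
  obtain ⟨v₀, 𝔓₁, h₁, hqv₀, h𝔓₁, hFrob₁, P₁, hP₁⟩ := hgoodq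
  have hv₀ : v₀ = w := HeightOneSpectrum.eq_of_natCast_mem_rat hqprime hqv₀ hqw
  subst hv₀
  obtain ⟨γ, -, hFrob⟩ := HeightOneSpectrum.exists_isArithFrobAt_conj_of_mem_primesAbove_holds h𝔓₁ h𝔓' hFrob₁
  set h := γ * h₁ * γ⁻¹ with hh
  have hne : ∃ P : geomTorsion W ((3 ^ 1 : ℕ) : ℤ), h • h • P ≠ P := by
    refine ⟨γ • P₁, fun heq ↦ hP₁ (smul_left_cancel γ ?_)⟩
    have hconj : h • h • γ • P₁ = γ • h₁ • h₁ • P₁ := by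
      rw [hh, ← mul_smul, ← mul_smul, ← mul_smul, ← mul_smul]
      congr 1
      group
    rw [← hconj, heq]
  have hχ := modPCyclotomicCharacterZMod_three_eq_one_of_isArithFrobAt hqprime hq3 hqw h𝔓' hFrob
  obtain ⟨hSt, hSl⟩ := structure_of_sq_of_cyclotomic_eq_one W hχ hne
  -- `h² = res F`, `F` a Frobenius at `𝔓`
  obtain ⟨F, hF⟩ := sq_mem_range_absGaloisRestrict K hK2 h
  have hf2 := inertiaDeg_eq_two_of_isPrime_span K hK2 hqprime hinert v hqv
  have hFrobF : IsArithFrobAt (𝓞 K) F 𝔓 :=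
    isArithFrobAt_of_absGaloisRestrict_eq_pow (F := ℚ) (M := K) hwv h𝔓 hFrob (by rw [hF, hf2])
  -- `F` acts on `E(K̄)[3]` as `h²` through `θ : E(ℚ̄)[3] ≃ E(K̄)[3]`
  set θ := RatClosure.torsionEquiv (K := K) W ((3 ^ 1 : ℕ) : ℤ) with hθ
  have hFθ : ∀ P : geomTorsion W ((3 ^ 1 : ℕ) : ℤ), F • θ P = θ (h • h • P) := fun P ↦ by
    rw [← RatClosure.torsionEquiv_smul, hF, pow_two, mul_smul]
  refine ⟨F, hFrobF, fun y hy ↦ ?_, fun y ↦ ?_⟩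
  · obtain ⟨P, rfl⟩ := θ.surjective y
    rw [hFθ] at hy
    obtain ⟨m, hm⟩ := hSt P (θ.injective hy)
    refine ⟨θ m, ?_⟩
    rw [hFθ, ← map_sub, ← hm]
  · obtain ⟨P, rfl⟩ := θ.surjective y
    rcases hSl P with ⟨m, hm⟩ | hgen
    · refine Or.inl ⟨θ m, ?_⟩
      rw [hFθ, ← map_sub, ← hm]
    · refine Or.inr fun z ↦ ?_
      obtain ⟨Q, rfl⟩ := θ.surjective z
      obtain ⟨a, m, hQ⟩ := hgen Q
      refine ⟨a, θ m, ?_⟩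
      rw [hFθ, ← map_sub, ← map_zsmul, ← map_add, ← hQ]

end Quadratic

end LocalFrob

/-! ## §4 (Line) and (Trans) VERBATIM, at every good unipotent-admissible prime, for `[K : ℚ] = 2` -/

section Inputs

variable (W : WeierstrassCurve ℚ) [W.IsElliptic] [W.IsGloballyMinimal] (K : Type) [Field K] [NumberField K]

/-- The place above a unipotent-admissible prime is a place of good reduction of `E/K`, not above `3`. [folklore] -/
theorem hasGoodReductionAt_of_uAdmissible {q : ℕ} (hq : IsUAdmissiblePrime W K q) (v : HeightOneSpectrum (𝓞 K))
    (hqv : (q : 𝓞 K) ∈ v.asIdeal) :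
    (W.baseChange K).HasGoodReductionAt v ∧ ((((3 ^ 1 : ℕ) : ℤ) : 𝓞 K) ∉ v.asIdeal) := by
  obtain ⟨hqprime, hqN, -, hq3, -, -, -⟩ := hq
  have hqw : (q : 𝓞 ℚ) ∈ (v.under (𝓞 ℚ)).asIdeal := by
    change (q : 𝓞 ℚ) ∈ v.asIdeal.under (𝓞 ℚ)
    rw [Ideal.under_def, Ideal.mem_comap, map_natCast]; exact hqv
  haveI : v.asIdeal.LiesOver (v.under (𝓞 ℚ)).asIdeal := ⟨rfl⟩
  refine ⟨hasGoodReductionAt_baseChange_of_hasGoodReductionAt_rat W (v.under (𝓞 ℚ)) v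
      (LocalFrob.hasGoodReductionAt_rat_of_not_dvd_conductorNorm W hqprime hqN _ hqw), ?_⟩
  rw [Int.cast_natCast]
  exact not_mem_asIdeal_of_coprime K ((Nat.coprime_primes hqprime Nat.prime_three).mpr hq3) v hqv

/-- **(Line) of `selQ_rankLowering_on_of_localGlobal`, DISCHARGED for `[K : ℚ] = 2`**: at the place `v ∣ q` of a
good unipotent-admissible prime `q` (`Frob_q² ≠ 1` on `E[3]`), the localisations of the classes of `H¹(K, E[3])`
satisfying E's Kummer condition at `v` are the integer multiples of ONE class of `H¹(K_v, E[3])` (`H¹_f(K_v, E[3])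
= H¹_ur ≅ E[3]/(Frob_v − 1)E[3]` is a line: Bertolini–Darmon Lemma 2.6 ∕ koly U1 at `p = 3`). Kernel proof:
`LocalFrob.exists_torsionLocMap_selmerLocalKer_eq_zsmul` + `LocalFrob.exists_frob_structure_of_uAdmissible`.
[cite: BertoliniDarmon2005, §2.2 Lemma 2.6] [cite: WZhang2014, §4.1, Prop. 5.4] -/
theorem localLine_of_uAdmissible (hK2 : Module.finrank ℚ K = 2) :
    ∀ (q : {q // IsUAdmissiblePrime W K q}) (v : HeightOneSpectrum (𝓞 K)), FrobSqNeOneAt W 3 q.1 →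
      ((q : ℕ) : 𝓞 K) ∈ v.asIdeal →
      ∃ ℓ, ∀ y ∈ selmerLocalKer (W.baseChange K) (v.adicCompletion K) ((3 ^ 1 : ℕ) : ℤ),
        ∃ a : ℤ, (W.baseChange K).torsionLocMap (v.adicCompletion K) ((3 ^ 1 : ℕ) : ℤ) y = a • ℓ := by
  intro q v hgoodq hqv
  obtain ⟨hgood, h3v⟩ := hasGoodReductionAt_of_uAdmissible W K q.2 v hqv
  obtain ⟨𝔐, h𝔐⟩ := v.localPrimesAbove_nonempty
  obtain ⟨F, hF, -, hSl⟩ := LocalFrob.exists_frob_structure_of_uAdmissible W K hK2 q.2 hgoodq v hqv h𝔐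
  exact LocalFrob.exists_torsionLocMap_selmerLocalKer_eq_zsmul (W.baseChange K) hgood (n := 3 ^ 1) (by norm_num)
    h3v h𝔐 hF hSl

/-- **(Trans) of `selQ_rankLowering_on_of_localGlobal`, DISCHARGED for `[K : ℚ] = 2`**: at the place `v ∣ q` of a
good unipotent-admissible prime, a class `z` satisfying the ORDINARY condition at `v` whose localisation is a multiple
of the localisation of a class `y` satisfying the Kummer condition at `v` has localisation ZERO (`H¹_f ∩ H¹_ord = 0`:
the finite and ordinary lines of `H¹(K_v, E[3])` are transverse; Bertolini–Darmon Lemma 2.6 ∕ koly U4 at `p = 3`).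
Kernel proof: `z − a y` has localisation `0`, so `z` is Kummer at `v` too, and
`LocalFrob.selmerLocalKer_inf_ordinaryLocalKer_le_torsionLocalKer` + `LocalFrob.exists_frob_structure_of_uAdmissible`.
[cite: BertoliniDarmon2005, §2.2 Lemma 2.6] [cite: WZhang2014, §4.1, Prop. 5.4] -/
theorem localTrans_of_uAdmissible (hK2 : Module.finrank ℚ K = 2) :
    ∀ (q : {q // IsUAdmissiblePrime W K q}) (v : HeightOneSpectrum (𝓞 K)), FrobSqNeOneAt W 3 q.1 →
      ((q : ℕ) : 𝓞 K) ∈ v.asIdeal →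
      ∀ y z : V3 W K, y ∈ selmerLocalKer (W.baseChange K) (v.adicCompletion K) ((3 ^ 1 : ℕ) : ℤ) →
        z ∈ (W.baseChange K).ordinaryLocalKer (v.adicCompletion K) ((3 ^ 1 : ℕ) : ℤ) →
        (∃ a : ℤ, (W.baseChange K).torsionLocMap (v.adicCompletion K) ((3 ^ 1 : ℕ) : ℤ) z =
          a • (W.baseChange K).torsionLocMap (v.adicCompletion K) ((3 ^ 1 : ℕ) : ℤ) y) →
        (W.baseChange K).torsionLocMap (v.adicCompletion K) ((3 ^ 1 : ℕ) : ℤ) z = 0 := by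
  intro q v hgoodq hqv y z hy hz ⟨a, ha⟩
  obtain ⟨hgood, h3v⟩ := hasGoodReductionAt_of_uAdmissible W K q.2 v hqv
  obtain ⟨𝔐, h𝔐⟩ := v.localPrimesAbove_nonempty
  obtain ⟨F, hF, hSt, -⟩ := LocalFrob.exists_frob_structure_of_uAdmissible W K hK2 q.2 hgoodq v hqv h𝔐
  set loc := (W.baseChange K).torsionLocMap (v.adicCompletion K) ((3 ^ 1 : ℕ) : ℤ) with hloc
  -- `z − a y` has localisation zero, hence is Kummer at `v`; so is `z`
  have hza : z - a • y ∈ (W.baseChange K).torsionLocalKer (v.adicCompletion K) ((3 ^ 1 : ℕ) : ℤ) := by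
    change loc (z - a • y) = 0
    rw [map_sub, map_zsmul, ha, sub_self]
  have hzsel : z ∈ selmerLocalKer (W.baseChange K) (v.adicCompletion K) ((3 ^ 1 : ℕ) : ℤ) := by
    have h1 := (W.baseChange K).torsionLocalKer_le_selmerLocalKer (v.adicCompletion K) _ hza
    have h2 : z = (z - a • y) + a • y := by abel
    rw [h2]
    exact add_mem h1 (AddSubgroup.zsmul_mem _ hy a)
  exact LocalFrob.selmerLocalKer_inf_ordinaryLocalKer_le_torsionLocalKer (W.baseChange K) hgood (n := 3 ^ 1)
    (by norm_num) h3v h𝔐 hF hSt (AddSubgroup.mem_inf.mpr ⟨hzsel, hz⟩)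

end Inputs

end Summit.BirchSwinnertonDyer.Rank1Residual.X11b.Three.Koly.Method2

end
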